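import Summits.Ventures.HodgeRepro2.T5Multiplicity
import Summits.Ventures.HodgeRepro2.T5IsotypicDecomposition
import Summits.Ventures.HodgeRepro2.T5CharacterTheory
import Summits.Ventures.HodgeRepro2.T5CharacterBasics
import Summits.Ventures.HodgeRepro2.T5HaarUniqueCompact

/-!
# The character projector `P_σ = dim σ · ∫ conj χ_σ(g) π(g) dg` onto the `σ`-isotypic component

Tier-5 support (N4.3 = (R3), steps (P2) / (P2′): «the K-type decomposition» and «the projection
to the K-type» of a continuous finite-dimensional representation of a compact group;
route/T5-SUPPORT-p1.md §S4.9–§S4.11).  For a compact Hausdorff group `G`, a bi-invariant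
probability measure `μ` (e.g. `haarProb G`, `T5HaarUniqueCompact`), a continuous representation
`π` on a finite-dimensional `V` and a continuous irreducible `σ` on `W₀`:

* `charProj μ π σ : V →ₗ[ℂ] V`, `v ↦ dim W₀ • ∫ conj (χ_σ g) • π g v ∂μ`;
* `charProj_comm`: it commutes with `π` (conjugation invariance of `μ` and of the character);
* `charProj_mem`: it preserves every stable subspace; `charProj_restrict_smul`: on an irreducible
  stable subspace it is a scalar (Schur); `trace_charProj_restrict`: the scalar is read off from
  the trace `dim W₀ · ∫ conj χ_σ · χ_W`;
* `charProj_apply_of_isCopyOf` / `charProj_apply_eq_zero_of_isEmpty_equiv`: the scalar is `1` on a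
  copy of `σ` and `0` on an irreducible subspace not equivalent to `σ` (character orthogonality,
  `T5CharacterTheory.integral_character_mul_conj_eq_ite`);
* `charProj_eq_sum_proj` / `charProj_apply_mem_isotypic` / `charProj_apply_eq_self_iff` /
  `charProj_idempotent` / `range_charProj`: `charProj` IS the projector onto the `σ`-isotypic
  component `T5IsotypicCopies.isotypic π σ` along the other isotypic components.

What this file does NOT say: anything about infinite-dimensional representations (the K-type
projectors of `π₃⁺` — [C] in N4.3); nothing about `(N)`.

Blind lane: Mathlib + own prefix; no sorry; axioms ⊆ {propext, Classical.choice, Quot.sound}.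
-/

namespace Summit.Ventures.HodgeRepro2.T5KTypeProjector

open MeasureTheory
open Summit.Ventures.HodgeRepro2.T5SchurOrthogonality Summit.Ventures.HodgeRepro2.T5SchurMathlib
  Summit.Ventures.HodgeRepro2.T5CompleteReducibility Summit.Ventures.HodgeRepro2.T5RestrictionRep
  Summit.Ventures.HodgeRepro2.T5IsotypicCopies Summit.Ventures.HodgeRepro2.T5CharacterBasics
  Summit.Ventures.HodgeRepro2.T5Multiplicity Summit.Ventures.HodgeRepro2.T5CharacterTheory

variable {G : Type*} [Group G] [TopologicalSpace G] [MeasurableSpace G] [BorelSpace G]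
  [CompactSpace G]
variable {V : Type*} [NormedAddCommGroup V] [InnerProductSpace ℂ V] [FiniteDimensional ℂ V]
variable {W₀ : Type*} [NormedAddCommGroup W₀] [InnerProductSpace ℂ W₀] [FiniteDimensional ℂ W₀]
variable (μ : Measure G) [IsProbabilityMeasure μ]
variable (π : G →* V →L[ℂ] V) (σ : G →* W₀ →L[ℂ] W₀)

omit [MeasurableSpace G] [BorelSpace G] [CompactSpace G] [FiniteDimensional ℂ V] in
/-- `g ↦ π g v` is continuous for a continuous representation. -/
lemma continuous_apply_const (hπ : Continuous π) (v : V) : Continuous fun g => π g v :=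
  (ContinuousLinearMap.apply ℂ V v).continuous.comp hπ

omit [FiniteDimensional ℂ V] in
/-- The integrand `conj (χ_σ g) • π g v` is integrable. -/
lemma integrable_charProj (hπ : Continuous π) (hσ : Continuous σ) (v : V) :
    Integrable (fun g => (starRingEnd ℂ) (character σ g) • π g v) μ :=
  ((Complex.continuous_conj.comp (continuous_character σ hσ)).smul
    (continuous_apply_const π hπ v)).integrable_of_hasCompactSupport
    (HasCompactSupport.of_compactSpace _)

/-- The character projector on vectors: `dim W₀ • ∫ conj (χ_σ g) • π g v ∂μ`. -/
noncomputable def charProjFun (v : V) : V :=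
  (Module.finrank ℂ W₀ : ℂ) • ∫ g, (starRingEnd ℂ) (character σ g) • π g v ∂μ

/-- The character projector `P_σ = dim W₀ · ∫ conj (χ_σ g) π g dg` as a linear map. -/
noncomputable def charProj (hπ : Continuous π) (hσ : Continuous σ) : V →ₗ[ℂ] V where
  toFun := charProjFun μ π σ
  map_add' v w := by
    haveI := FiniteDimensional.complete ℂ V
    simp only [charProjFun, map_add, smul_add]
    rw [integral_add (integrable_charProj μ π σ hπ hσ v) (integrable_charProj μ π σ hπ hσ w),
      smul_add]
  map_smul' c v := by
    simp only [charProjFun, map_smul, RingHom.id_apply]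
    simp_rw [smul_comm _ c]
    rw [integral_smul, smul_comm]

omit [FiniteDimensional ℂ V] in
/-- The value of the character projector. -/
lemma charProj_apply (hπ : Continuous π) (hσ : Continuous σ) (v : V) :
    charProj μ π σ hπ hσ v =
      (Module.finrank ℂ W₀ : ℂ) • ∫ g, (starRingEnd ℂ) (character σ g) • π g v ∂μ :=
  rfl

section Invariant

variable [IsTopologicalGroup G] [μ.IsMulLeftInvariant] [μ.IsMulRightInvariant]

omit [CompactSpace G] [IsProbabilityMeasure μ] in
/-- Conjugation invariance of a bi-invariant measure: `∫ F = ∫ F (h x h⁻¹)`. -/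
lemma integral_conj_eq_self {E : Type*} [NormedAddCommGroup E] [NormedSpace ℝ E] (F : G → E)
    (h : G) : ∫ x, F x ∂μ = ∫ x, F (h * (x * h⁻¹)) ∂μ := by
  rw [← integral_mul_left_eq_self F h, ← integral_mul_right_eq_self (fun x => F (h * x)) h⁻¹]

/-- The character projector commutes with the representation. -/
lemma charProj_comm (hπ : Continuous π) (hσ : Continuous σ) (h : G) (v : V) :
    charProj μ π σ hπ hσ (π h v) = π h (charProj μ π σ hπ hσ v) := by
  haveI := FiniteDimensional.complete ℂ V
  rw [charProj_apply, charProj_apply, map_smul,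
    ← ContinuousLinearMap.integral_comp_comm (π h) (integrable_charProj μ π σ hπ hσ v)]
  congr 1
  have hmul : ∀ a b : G, ∀ w : V, π a (π b w) = π (a * b) w := fun a b w => by
    rw [map_mul]; rfl
  simp only [map_smul, hmul]
  rw [integral_conj_eq_self μ (fun x => (starRingEnd ℂ) (character σ x) • π (x * h) v) h]
  congr 1
  funext x
  rw [← mul_assoc, character_conj, inv_mul_cancel_right]

end Invariant

/-- The character projector preserves every stable subspace. -/
lemma charProj_mem (hπ : Continuous π) (hσ : Continuous σ) {W : Submodule ℂ V} (hW : IsStable π W)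
    {v : V} (hv : v ∈ W) : charProj μ π σ hπ hσ v ∈ W := by
  haveI := FiniteDimensional.complete ℂ V
  rw [charProj_apply]
  refine W.smul_mem _ ?_
  have hconv : Convex ℝ (W : Set V) := by
    have := (W.restrictScalars ℝ).convex
    simpa using this
  exact Convex.integral_mem hconv W.closed_of_finiteDimensional
    (Filter.Eventually.of_forall fun g => W.smul_mem _ (hW g v hv))
    (integrable_charProj μ π σ hπ hσ v)

/-- The restriction of the character projector to a stable subspace. -/
noncomputable def charProjRestrict (hπ : Continuous π) (hσ : Continuous σ) (W : Submodule ℂ V)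
    (hW : IsStable π W) : W →ₗ[ℂ] W :=
  (charProj μ π σ hπ hσ).restrict fun _ hv => charProj_mem μ π σ hπ hσ hW hv

/-- The restriction agrees with the projector. -/
lemma coe_charProjRestrict_apply (hπ : Continuous π) (hσ : Continuous σ) (W : Submodule ℂ V)
    (hW : IsStable π W) (x : W) :
    (charProjRestrict μ π σ hπ hσ W hW x : V) = charProj μ π σ hπ hσ x := rfl

/-- The trace of the restricted projector: `dim W₀ · ∫ conj (χ_σ g) · χ_W g ∂μ`. -/
lemma trace_charProjRestrict (hπ : Continuous π) (hσ : Continuous σ) (W : Submodule ℂ V)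
    (hW : IsStable π W) :
    LinearMap.trace ℂ W (charProjRestrict μ π σ hπ hσ W hW) =
      (Module.finrank ℂ W₀ : ℂ) *
        ∫ g, (starRingEnd ℂ) (character σ g) * character (restrictRep π W hW) g ∂μ := by
  haveI := FiniteDimensional.complete ℂ V
  let b := stdOrthonormalBasis ℂ W
  rw [LinearMap.trace_eq_sum_inner _ b]
  have hterm : ∀ i, inner ℂ (b i) (charProjRestrict μ π σ hπ hσ W hW (b i)) =
      (Module.finrank ℂ W₀ : ℂ) *
        ∫ g, (starRingEnd ℂ) (character σ g) * inner ℂ (b i : V) (π g (b i)) ∂μ := by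
    intro i
    rw [Submodule.coe_inner, coe_charProjRestrict_apply, charProj_apply, inner_smul_right,
      ← integral_inner (integrable_charProj μ π σ hπ hσ (b i))]
    congr 1
    refine integral_congr_ae (Filter.Eventually.of_forall fun g => ?_)
    simp only [inner_smul_right]
  simp_rw [hterm]
  rw [← Finset.mul_sum]
  congr 1
  rw [← integral_finsetSum _ fun i _ => ?_]
  · refine integral_congr_ae (Filter.Eventually.of_forall fun g => ?_)
    show ∑ i, (starRingEnd ℂ) (character σ g) * inner ℂ (b i : V) (π g (b i)) =
      (starRingEnd ℂ) (character σ g) * character (restrictRep π W hW) g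
    rw [← Finset.mul_sum, character_eq_sum (restrictRep π W hW) b g]
    congr 1
  · exact ((Complex.continuous_conj.comp (continuous_character σ hσ)).mul
      (continuous_inner.comp (continuous_const.prodMk
        (continuous_apply_const π hπ (b i))))).integrable_of_hasCompactSupport
      (HasCompactSupport.of_compactSpace _)

/-- The scalar of `charProj_restrict_smul` times `dim W` is the trace. -/
lemma trace_eq_of_forall_smul {W : Submodule ℂ V} (hW : IsStable π W) (hπ : Continuous π)
    (hσ : Continuous σ) {c : ℂ} (hc : ∀ v ∈ W, charProj μ π σ hπ hσ v = c • v) :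
    LinearMap.trace ℂ W (charProjRestrict μ π σ hπ hσ W hW) = c * Module.finrank ℂ W := by
  have : charProjRestrict μ π σ hπ hσ W hW = c • LinearMap.id := by
    ext x
    simp only [coe_charProjRestrict_apply, LinearMap.smul_apply, LinearMap.id_apply,
      Submodule.coe_smul]
    exact hc x x.2
  rw [this, map_smul, LinearMap.trace_id, smul_eq_mul]


section Irreducible

variable [IsTopologicalGroup G] [μ.IsMulLeftInvariant] [μ.IsMulRightInvariant]

/-- **Schur**: on an irreducible stable subspace the character projector is a scalar. -/
lemma charProj_restrict_smul (hπ : Continuous π) (hσ : Continuous σ) {W : Submodule ℂ V}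
    (hW : IsIrreducibleSubspace π W) :
    ∃ c : ℂ, ∀ v ∈ W, charProj μ π σ hπ hσ v = c • v := by
  haveI := nontrivial_of_isIrreducibleSubspace π W hW
  have hst : IsStable π W := hW.2.1
  let T : W →L[ℂ] W := LinearMap.toContinuousLinearMap (charProjRestrict μ π σ hπ hσ W hst)
  have hcomm : ∀ g, restrictRep π W hst g ∘L T = T ∘L restrictRep π W hst g := by
    intro g
    ext x
    simp only [ContinuousLinearMap.comp_apply, coe_restrictRep_apply, T,
      LinearMap.coe_toContinuousLinearMap', coe_charProjRestrict_apply]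
    rw [charProj_comm]
  obtain ⟨c, hc⟩ := exists_smul_eq_of_comm (restrictRep π W hst)
    (isIrreducible_restrictRep π W hW hst) T hcomm
  refine ⟨c, fun v hv => ?_⟩
  have := congrArg Subtype.val (hc ⟨v, hv⟩)
  simpa [T, coe_charProjRestrict_apply] using this

variable [μ.IsOpenPosMeasure]

/-- On an irreducible stable subspace not equivalent to `σ`, the character projector vanishes. -/
theorem charProj_apply_eq_zero_of_isEmpty_equiv (hπ : Continuous π) (hσ : Continuous σ)
    (hσi : IsIrreducible σ) [Nontrivial W₀] {W : Submodule ℂ V} (hW : IsIrreducibleSubspace π W)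
    (hne : IsEmpty ((toRep σ).Equiv (toRep (restrictRep π W hW.2.1)))) {v : V} (hv : v ∈ W) :
    charProj μ π σ hπ hσ v = 0 := by
  haveI := nontrivial_of_isIrreducibleSubspace π W hW
  obtain ⟨c, hc⟩ := charProj_restrict_smul μ π σ hπ hσ hW
  have htr := trace_eq_of_forall_smul μ π σ hW.2.1 hπ hσ hc
  rw [trace_charProjRestrict] at htr
  have hint :
      ∫ g, (starRingEnd ℂ) (character σ g) * character (restrictRep π W hW.2.1) g ∂μ = 0 := by
    have := T5CharacterTheory.integral_character_mul_conj_eq_ite μ (restrictRep π W hW.2.1) σ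
      (continuous_restrictRep π hπ W hW.2.1) hσ (isIrreducible_restrictRep π W hW hW.2.1) hσi
    rw [if_neg (not_nonempty_iff.mpr hne)] at this
    rw [← this]
    refine integral_congr_ae (Filter.Eventually.of_forall fun g => ?_)
    ring
  rw [hint, mul_zero] at htr
  have hc0 : c = 0 := by
    have hfin : (Module.finrank ℂ W : ℂ) ≠ 0 := by
      exact_mod_cast (Module.finrank_pos_iff.mpr inferInstance).ne'
    exact (mul_eq_zero.mp htr.symm).resolve_right hfin
  rw [hc v hv, hc0, zero_smul]

/-- On a copy of `σ`, the character projector is the identity. -/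
theorem charProj_apply_of_isCopyOf (hπ : Continuous π) (hσ : Continuous σ) (hσi : IsIrreducible σ)
    [Nontrivial W₀] {W : Submodule ℂ V} (hW : IsCopyOf π σ W) {v : V} (hv : v ∈ W) :
    charProj μ π σ hπ hσ v = v := by
  obtain ⟨hirr, ⟨e⟩⟩ := hW
  haveI := nontrivial_of_isIrreducibleSubspace π W hirr
  obtain ⟨c, hc⟩ := charProj_restrict_smul μ π σ hπ hσ hirr
  have htr := trace_eq_of_forall_smul μ π σ hirr.2.1 hπ hσ hc
  rw [trace_charProjRestrict] at htr
  have hint :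
      ∫ g, (starRingEnd ℂ) (character σ g) * character (restrictRep π W hirr.2.1) g ∂μ = 1 := by
    have := T5CharacterTheory.integral_character_mul_conj_eq_ite μ (restrictRep π W hirr.2.1) σ
      (continuous_restrictRep π hπ W hirr.2.1) hσ (isIrreducible_restrictRep π W hirr hirr.2.1) hσi
    rw [if_pos ⟨e⟩] at this
    rw [← this]
    refine integral_congr_ae (Filter.Eventually.of_forall fun g => ?_)
    ring
  rw [hint, mul_one] at htr
  have hdim : (Module.finrank ℂ W : ℂ) = Module.finrank ℂ W₀ := by
    exact_mod_cast (LinearEquiv.finrank_eq e.toLinearEquiv).symm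
  have hfin : (Module.finrank ℂ W : ℂ) ≠ 0 := by
    exact_mod_cast (Module.finrank_pos_iff.mpr inferInstance).ne'
  have hc1 : c = 1 := by
    rw [← hdim] at htr
    exact mul_right_cancel₀ hfin (htr.symm.trans (one_mul _).symm)
  rw [hc v hv, hc1, one_smul]

open Classical in
/-- The character projector on an internal irreducible decomposition `S`: it is the sum of the
projections onto the copies of `σ`. -/
theorem charProj_eq_sum_proj (hπ : Continuous π) (hσ : Continuous σ) (hσi : IsIrreducible σ)
    [Nontrivial W₀] (S : Finset (Submodule ℂ V)) (hint : DirectSum.IsInternal (fam S))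
    (hS : ∀ W ∈ S, IsIrreducibleSubspace π W) (v : V) :
    charProj μ π σ hπ hσ v =
      ∑ W : S, if IsCopyOf π σ (W : Submodule ℂ V) then proj S hint W v else 0 := by
  classical
  conv_lhs => rw [← sum_proj S hint v, map_sum]
  refine Finset.sum_congr rfl fun W _ => ?_
  by_cases hW : IsCopyOf π σ (W : Submodule ℂ V)
  · rw [if_pos hW]
    exact charProj_apply_of_isCopyOf μ π σ hπ hσ hσi hW (proj_apply_mem S hint W v)
  · rw [if_neg hW]
    have hirr := hS W W.2
    have hne : IsEmpty ((toRep σ).Equiv (toRep (restrictRep π W hirr.2.1))) := by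
      refine ⟨fun e => hW ⟨hirr, ⟨e⟩⟩⟩
    exact charProj_apply_eq_zero_of_isEmpty_equiv μ π σ hπ hσ hσi hirr hne
      (proj_apply_mem S hint W v)

/-- The character projector lands in the `σ`-isotypic component. -/
theorem charProj_apply_mem_isotypic (hπ : Continuous π) (hσ : Continuous σ) (hσi : IsIrreducible σ)
    [Nontrivial W₀] (v : V) : charProj μ π σ hπ hσ v ∈ isotypic π σ := by
  classical
  obtain ⟨S, hS, hint, -⟩ :=
    T5CharacterTheory.exists_decomposition_integral_character_eq_card μ π hπ
  rw [charProj_eq_sum_proj μ π σ hπ hσ hσi S hint hS v]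
  refine Submodule.sum_mem _ fun W _ => ?_
  by_cases hW : IsCopyOf π σ (W : Submodule ℂ V)
  · rw [if_pos hW]
    exact le_isotypic_of_isCopyOf π σ hW (proj_apply_mem S hint W v)
  · rw [if_neg hW]
    exact Submodule.zero_mem _

/-- The character projector is the identity on the `σ`-isotypic component. -/
theorem charProj_apply_of_mem_isotypic (hπ : Continuous π) (hσ : Continuous σ)
    (hσi : IsIrreducible σ) [Nontrivial W₀] {v : V} (hv : v ∈ isotypic π σ) :
    charProj μ π σ hπ hσ v = v := by
  induction hv using Submodule.iSup_induction' with
  | mem W x hx => exact charProj_apply_of_isCopyOf μ π σ hπ hσ hσi W.2 hx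
  | zero => exact map_zero _
  | add x y _ _ hx hy => rw [map_add, hx, hy]

/-- `charProj v = v` exactly on the `σ`-isotypic component. -/
theorem charProj_apply_eq_self_iff (hπ : Continuous π) (hσ : Continuous σ) (hσi : IsIrreducible σ)
    [Nontrivial W₀] (v : V) : charProj μ π σ hπ hσ v = v ↔ v ∈ isotypic π σ :=
  ⟨fun h => h ▸ charProj_apply_mem_isotypic μ π σ hπ hσ hσi v,
    fun hv => charProj_apply_of_mem_isotypic μ π σ hπ hσ hσi hv⟩

/-- The character projector is idempotent. -/
theorem charProj_idempotent (hπ : Continuous π) (hσ : Continuous σ) (hσi : IsIrreducible σ)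
    [Nontrivial W₀] (v : V) :
    charProj μ π σ hπ hσ (charProj μ π σ hπ hσ v) = charProj μ π σ hπ hσ v :=
  charProj_apply_of_mem_isotypic μ π σ hπ hσ hσi (charProj_apply_mem_isotypic μ π σ hπ hσ hσi v)

/-- **The range of the character projector is the `σ`-isotypic component.** -/
theorem range_charProj (hπ : Continuous π) (hσ : Continuous σ) (hσi : IsIrreducible σ)
    [Nontrivial W₀] : LinearMap.range (charProj μ π σ hπ hσ) = isotypic π σ := by
  ext v
  constructor
  · rintro ⟨w, rfl⟩
    exact charProj_apply_mem_isotypic μ π σ hπ hσ hσi w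
  · intro hv
    exact ⟨v, charProj_apply_of_mem_isotypic μ π σ hπ hσ hσi hv⟩

end Irreducible

section Haar

variable [IsTopologicalGroup G] [T2Space G]

open Summit.Ventures.HodgeRepro2.T5HaarUniqueCompact

/-- With the normalised Haar measure `haarProb G`: the character projector commutes with `π`. -/
theorem charProj_comm_haar (hπ : Continuous π) (hσ : Continuous σ) (h : G) (v : V) :
    charProj (haarProb G) π σ hπ hσ (π h v) = π h (charProj (haarProb G) π σ hπ hσ v) :=
  charProj_comm (haarProb G) π σ hπ hσ h v

/-- With the normalised Haar measure: `charProj v = v` exactly on the `σ`-isotypic component. -/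
theorem charProj_apply_eq_self_iff_haar (hπ : Continuous π) (hσ : Continuous σ)
    (hσi : IsIrreducible σ) [Nontrivial W₀] (v : V) :
    charProj (haarProb G) π σ hπ hσ v = v ↔ v ∈ isotypic π σ :=
  charProj_apply_eq_self_iff (haarProb G) π σ hπ hσ hσi v

/-- **With the normalised Haar measure, `dim σ · ∫ conj χ_σ(g) π(g) dg` is the projector onto the
`σ`-isotypic component.** -/
theorem range_charProj_haar (hπ : Continuous π) (hσ : Continuous σ) (hσi : IsIrreducible σ)
    [Nontrivial W₀] : LinearMap.range (charProj (haarProb G) π σ hπ hσ) = isotypic π σ :=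
  range_charProj (haarProb G) π σ hπ hσ hσi

end Haar

end Summit.Ventures.HodgeRepro2.T5KTypeProjector
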